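import Literature.MathematicalPhysics.KineticTheory.HardSphereBBGKYRegularity
import Literature.MathematicalPhysics.KineticTheory.HardSphereHierarchyModelOn
import HarnessLib

/-!
# (R'): the Duhamel terms of the hard-sphere hierarchy respect null sets on families supported
# in the domain
(Bodineau–Gallagher–Saint-Raymond 2016 §3.1 Remark 3.1, p. 9, and §5.1 p. 15; Simonella 2014;
trunk T-KINETIC, topic MathematicalPhysics/KineticTheory; input (R') of
`bodineau_gallagher_saintRaymond_linear_of_inputs` / `HardSphereHierarchyModelOn` of the bottom-up
plan towards fact (c) `bodineau_gallagher_saintRaymond_linear`.)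

We prove `respectsAEOn_hsHierarchyModel`: for `d ≥ 2` and `0 < ε < 1/2`, the Duhamel terms of the
hard-sphere model `hsHierarchyModel` (regularised Alexander flows, outgoing collision operators)
respect Lebesgue-null sets on nice families vanishing off the hard-sphere domains
(`HierarchyModel.RespectsAEOn … (fun _ => volume) (hard-sphere domains)`), i.e. BGSR's Remark 3.1
/ "the pseudo-trajectories are non-singular" in the form consumed by the pruning argument.

Architecture (the non-singularity of the BBGKY pseudo-trajectories, by induction on the order):

* §1 The avoidance property of a configuration `W`: "for `dt₂ ⊗ ds`-almost
  every `(t₂, s)`, `(t₂, Φ_{-s} W) ∉ 𝒩`" for a `dt ⊗ dZ`-null measurable `𝒩 ⊆ ℝ × D^{k}`; it is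
  PERSISTENT along free stretches of the flow (translation invariance of `ds`, group law), and
  its failure set inside the domain is Lebesgue-null (Fubini, the regularised flow preserving
  null sets, `ae_comp_regFlow`); hence, by the flux engine `ae_lossConfig_of_persistent` and the
  flux form of Alexander's theorem `ae_lossConfig_mem_good`, almost every outgoing adjoined
  configuration is good and avoids `𝒩` (`ae_avoids_lossConfig`), and — by the scattering of the
  parameters, `measurePreserving_scatterSkew` — the same holds in the form read by the outgoing
  collision operator in both the gain and the loss terms (`ae_avoidsClause`).
* §2 The Duhamel integrand `E_n(G)(k, t, Y) := (C^{out}_{k,k+1} Q_{k+1,k+1+n}(t) G)(Y)`; the sets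
  `𝒩_n := {(t, Y) : E_n(G₁) ≠ E_n(G₂)}` are `dt ⊗ dY`-null for nice families `G₁ = G₂` a.e.
  vanishing off the domains (`ae_duhamelIntegrand_eq`, induction on `n`: the reads of
  `Q_{k+1,k+1+n}(t) G` at the outgoing representative `W` are `G^{(k+1)}(Φ_{-t} W)` (`n = 0`) or
  `∫_0^t E_{n-1}(G)(k+1, t₂, Φ_{-(t-t₂)} W) dt₂`, both governed by `AvoidsAE` through the
  measure-preserving shear `(t, t₂) ↦ (t₂, t - t₂)`; reads outside the domain vanish by support
  preservation), and then `Q_{k,k+n+1}(h) G₁ = Q_{k,k+n+1}(h) G₂` a.e.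
  (`respectsAEOn_hsHierarchyModel`).

## References

* T. Bodineau, I. Gallagher, L. Saint-Raymond, Invent. Math. 203 (2016), arXiv:1305.3397v2,
  §3.1 Remark 3.1 p. 9; §5.1 p. 15 (semigroup notation; Simonella's non-singularity).
* S. Simonella, *Evolution of correlation functions in the hard sphere dynamics*, J. Stat. Phys.
  155 (2014) 1191–1221.
-/

open MeasureTheory Metric Real Set Filter Function
open scoped Nat InnerProductSpace ENNReal
open Literature.Analysis.FluidPDE (Config configEnergy GCState duhamelTerm duhamelTerm_zero
  duhamelTerm_succ Geometry hardSphereDomain collidePair hsCollisionTerm bbgkyCollisionOp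
  lossConfig gainConfig appendParticle freeFlight reflectVel liouville)
open Literature.Analysis.FluidPDE

namespace Literature.MathematicalPhysics.KineticTheory

noncomputable section

section Kinetic

variable {d : Type*} [Fintype d]

/-! ## §1. Avoiding a space-time null set along the backward flow -/

section Avoid

variable {ε : ℝ} (hε : 0 < ε) (hε' : ε < 2⁻¹)

include hε hε'

omit hε in
/-- The space-time read `(V, (t₂, s)) ↦ (t₂, Φ_{-s} V)` is measurable. [folklore] -/
theorem measurable_spaceTimeRead (k : ℕ) :
    Measurable fun x : Config k d (UnitAddTorus d) × (ℝ × ℝ) =>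
      ((x.2.1, Alexander.regFlow (Torus.geometry d) ε (-x.2.2) x.1) : ℝ × Config k d (UnitAddTorus d)) := by
  have h1 : Measurable fun x : Config k d (UnitAddTorus d) × (ℝ × ℝ) => x.2.1 := measurable_snd.fst
  have h2 : Measurable fun x : Config k d (UnitAddTorus d) × (ℝ × ℝ) => ((-x.2.2, x.1) : ℝ × Config k d (UnitAddTorus d)) :=
    measurable_snd.snd.neg.prodMk measurable_fst
  have h3 := (Alexander.measurable_regFlow_uncurry (N := k) (d := d) hε').comp h2
  exact h1.prodMk h3

/-- **The failure set of `AvoidsAE` inside the good set is Lebesgue-null** when `𝒩` is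
`dt ⊗ dZ`-null: by Fubini, for almost every `(t₂, s)` the section `𝒩_{t₂}` is null and
`Φ_{-s}` pulls it back to a null set (`ae_comp_regFlow`). [folklore] -/
theorem ae_avoidsAE {k : ℕ} {𝒩 : Set (ℝ × Config k d (UnitAddTorus d))} (h𝒩m : MeasurableSet 𝒩)
    (h𝒩0 : ((volume : Measure ℝ).prod (volume : Measure (Config k d (UnitAddTorus d)))) 𝒩 = 0) :
    ∀ᵐ W : Config k d (UnitAddTorus d),
      ∀ᵐ p : ℝ × ℝ ∂((volume : Measure ℝ).prod (volume : Measure ℝ)),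
        (p.1, Alexander.regFlow (Torus.geometry d) ε (-p.2) W) ∉ 𝒩 := by
  haveI hXE : SigmaFinite (volume : Measure (UnitAddTorus d × EuclideanSpace ℝ d)) := inferInstance
  haveI hC : SigmaFinite (volume : Measure (Config k d (UnitAddTorus d))) := inferInstance
  -- a.e. section of `𝒩` is null
  have hsec : ∀ᵐ t₂ : ℝ, ∀ᵐ V : Config k d (UnitAddTorus d), (t₂, V) ∉ 𝒩 :=
    Measure.ae_ae_of_ae_prod (measure_eq_zero_iff_ae_notMem.1 h𝒩0)
  -- hence for every `(t₂, s)` with null section, a.e. `W` avoids it after transport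
  have hp : ∀ᵐ p : ℝ × ℝ ∂((volume : Measure ℝ).prod (volume : Measure ℝ)),
      ∀ᵐ W : Config k d (UnitAddTorus d), (p.1, Alexander.regFlow (Torus.geometry d) ε (-p.2) W) ∉ 𝒩 := by
    have h1 : ∀ᵐ p : ℝ × ℝ ∂((volume : Measure ℝ).prod (volume : Measure ℝ)),
        ∀ᵐ V : Config k d (UnitAddTorus d), (p.1, V) ∉ 𝒩 := by
      have := (Measure.ae_prod_iff_ae_ae (μ := (volume : Measure ℝ)) (ν := (volume : Measure ℝ))
        (p := fun p : ℝ × ℝ => ∀ᵐ V : Config k d (UnitAddTorus d), (p.1, V) ∉ 𝒩) ?_).2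
        (hsec.mono fun t₂ ht₂ => ae_of_all _ fun _ => ht₂)
      · exact this
      · have hm : MeasurableSet {x : (ℝ × ℝ) × Config k d (UnitAddTorus d) | ((x.1.1, x.2) : ℝ × Config k d (UnitAddTorus d)) ∉ 𝒩} :=
          (h𝒩m.preimage (measurable_fst.fst.prodMk measurable_snd)).compl
        exact measurableSet_setOf_ae_mem (volume : Measure (Config k d (UnitAddTorus d))) hm
    filter_upwards [h1] with p hp1
    exact ae_comp_regFlow (d := d) hε hε' (Q := fun V => (p.1, V) ∉ 𝒩) hp1 (-p.2)
  -- Fubini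
  have hm : MeasurableSet {x : Config k d (UnitAddTorus d) × (ℝ × ℝ) |
      ((x.2.1, Alexander.regFlow (Torus.geometry d) ε (-x.2.2) x.1) : ℝ × Config k d (UnitAddTorus d)) ∉ 𝒩} :=
    (h𝒩m.preimage (measurable_spaceTimeRead hε' k)).compl
  exact (Measure.ae_ae_comm (μ := (volume : Measure (Config k d (UnitAddTorus d))))
    (ν := ((volume : Measure ℝ).prod (volume : Measure ℝ)))
    (p := fun W p => ((p.1, Alexander.regFlow (Torus.geometry d) ε (-p.2) W) : ℝ × Config k d (UnitAddTorus d)) ∉ 𝒩) hm).2 hp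

omit hε in
/-- The set of configurations satisfying the almost-everywhere avoidance is measurable. [folklore] -/
theorem measurableSet_setOf_avoids {k : ℕ} {𝒩 : Set (ℝ × Config k d (UnitAddTorus d))} (h𝒩m : MeasurableSet 𝒩) :
    MeasurableSet {W : Config k d (UnitAddTorus d) |
      ∀ᵐ p : ℝ × ℝ ∂((volume : Measure ℝ).prod (volume : Measure ℝ)),
        (p.1, Alexander.regFlow (Torus.geometry d) ε (-p.2) W) ∉ 𝒩} :=
  measurableSet_setOf_ae_mem ((volume : Measure ℝ).prod (volume : Measure ℝ))
    (h𝒩m.preimage (measurable_spaceTimeRead hε' k)).compl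

/-- **Persistence of the avoidance property along free stretches**: if `W₀` is NOT (good and
avoiding `𝒩` a.e.), and its free flight keeps all pairs `> ε` apart during `(0, τ]`, `0 < τ`,
then `S_τ W₀` lies in the null set of configurations of the domain which are not good or do not
avoid `𝒩` a.e.: if `S_τ W₀` is good then so is `W₀` (`Alexander.mem_good_of_freeFlight_mem_good`),
`S_τ W₀ = Φ_τ W₀` (free stretch), and `Φ_{-s} W₀ = Φ_{-(s+τ)} Φ_τ W₀` with the translation
`s ↦ s + τ` preserving `ds`. [folklore] -/
theorem freeFlight_mem_of_not_goodAvoids {k : ℕ} {𝒩 : Set (ℝ × Config k d (UnitAddTorus d))}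
    {W₀ : Config k d (UnitAddTorus d)} {τ : ℝ} (hτ0 : 0 < τ)
    (hwin : ∀ u ∈ Ioc 0 τ, ∀ j l : Fin k, j ≠ l →
      ε < ‖(Torus.geometry d).sepVec (freeFlight (Torus.geometry d) u W₀ j).1 (freeFlight (Torus.geometry d) u W₀ l).1‖)
    (hnot : ¬ (W₀ ∈ Alexander.good (N := k) (Torus.geometry d) ε ∧
      W₀ ∈ {W : Config k d (UnitAddTorus d) | ∀ᵐ p : ℝ × ℝ ∂((volume : Measure ℝ).prod (volume : Measure ℝ)),
        (p.1, Alexander.regFlow (Torus.geometry d) ε (-p.2) W) ∉ 𝒩})) :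
    freeFlight (Torus.geometry d) τ W₀ ∈ hardSphereDomain (Torus.geometry d) k ε ∩
      ((Alexander.good (N := k) (Torus.geometry d) ε)ᶜ ∪
        {W : Config k d (UnitAddTorus d) | ∀ᵐ p : ℝ × ℝ ∂((volume : Measure ℝ).prod (volume : Measure ℝ)),
          (p.1, Alexander.regFlow (Torus.geometry d) ε (-p.2) W) ∉ 𝒩}ᶜ) := by
  refine ⟨fun j l hjl => (hwin τ ⟨hτ0, le_rfl⟩ j l hjl).le, ?_⟩
  by_contra hc
  simp only [mem_union, mem_compl_iff, mem_setOf_eq, not_or, not_not] at hc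
  obtain ⟨hgood, hV⟩ := hc
  apply hnot
  have hsep : ∀ u ∈ Ioc 0 τ, ∀ j l : Fin k, j ≠ l →
      ‖(Torus.geometry d).sepVec (freeFlight (Torus.geometry d) u W₀ j).1 (freeFlight (Torus.geometry d) u W₀ l).1‖ ≠ ε :=
    fun u hu j l hjl => (hwin u hu j l hjl).ne'
  have hW₀ : W₀ ∈ Alexander.good (N := k) (Torus.geometry d) ε :=
    Alexander.mem_good_of_freeFlight_mem_good hε hε' hτ0.le hsep hgood
  refine ⟨hW₀, ?_⟩
  -- the free stretch
  set Φ := Alexander.regHardSphereFlow (d := d) hε hε' k with hΦ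
  have hflow : Alexander.regFlow (Torus.geometry d) ε τ W₀ = freeFlight (Torus.geometry d) τ W₀ := by
    have := Φ.flow_eq_freeFlight_of_freeFlight_ne Torus.continuous_geometry_translate (z := W₀) hW₀ hsep τ
      ⟨hτ0.le, le_rfl⟩
    simpa [hΦ] using this
  -- pull the avoidance of `V = Φ_τ W₀` back by the translation `s ↦ s + τ`
  have htr : MeasurePreserving (fun p : ℝ × ℝ => (p.1, p.2 + τ)) ((volume : Measure ℝ).prod volume)
      ((volume : Measure ℝ).prod volume) :=
    (MeasurePreserving.id volume).prod (measurePreserving_add_right volume τ)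
  have h := htr.quasiMeasurePreserving.ae hV
  simp only [mem_setOf_eq]
  filter_upwards [h] with p hp
  have key : Alexander.regFlow (Torus.geometry d) ε (-(p.2 + τ)) (freeFlight (Torus.geometry d) τ W₀) =
      Alexander.regFlow (Torus.geometry d) ε (-p.2) W₀ := by
    rw [← hflow, ← Alexander.regFlow_add hε hε']
    congr 1
    ring
  simpa only [key] using hp

/-- **The flux engine for a persistent property "good and in `R`"** (abstracted from
`ae_regularityClause`): if `Rᶜ` is Lebesgue-null and measurable, and "good and in `R`" is
persistent along outgoing free stretches in the sense of `ae_lossConfig_of_persistent`, then for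
almost every `k`-configuration and `σ ⊗ dv`-almost every (impact direction, velocity), in the
gain case as in the loss case, the outgoing representative of an adjoined configuration of the
domain is good and lies in `R` (gain: the engine and `outRep ∘ gainConfig = lossConfig`; loss:
the engine at the scattered parameters, `measurePreserving_scatterSkew`). [folklore] -/
theorem ae_goodClause_of_persistent (hd : 2 ≤ Fintype.card d) {m : ℕ} (i : Fin (m + 1))
    {R : Set (Config (m + 1 + 1) d (UnitAddTorus d))} (hRm : MeasurableSet R) (hR0 : volume Rᶜ = 0)
    (hpers : ∀ (W₀ : Config (m + 1 + 1) d (UnitAddTorus d)) (τ : ℝ), 0 < τ → τ ≤ 1 →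
      (∀ u ∈ Ioc 0 τ, ∀ j l : Fin (m + 1 + 1), j ≠ l →
        ε < ‖(Torus.geometry d).sepVec (freeFlight (Torus.geometry d) u W₀ j).1 (freeFlight (Torus.geometry d) u W₀ l).1‖) →
      ¬ (W₀ ∈ Alexander.good (N := m + 1 + 1) (Torus.geometry d) ε ∧ W₀ ∈ R) →
      freeFlight (Torus.geometry d) τ W₀ ∈ hardSphereDomain (Torus.geometry d) (m + 1 + 1) ε ∩
        ((Alexander.good (N := m + 1 + 1) (Torus.geometry d) ε)ᶜ ∪ Rᶜ)) :
    ∀ᵐ Z' : Config (m + 1) d (UnitAddTorus d),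
      ∀ᵐ q : sphere (0 : EuclideanSpace ℝ d) 1 × EuclideanSpace ℝ d
          ∂((sphereMeasure (E := EuclideanSpace ℝ d)).prod volume),
        (0 < ⟪(q.1 : EuclideanSpace ℝ d), q.2 - (Z' i).2⟫_ℝ →
          gainConfig (Torus.geometry d) ε Z' i q.1 q.2 ∈ hardSphereDomain (Torus.geometry d) (m + 1 + 1) ε →
          outRep (Torus.geometry d) (m + 1) i (gainConfig (Torus.geometry d) ε Z' i q.1 q.2) ∈
            Alexander.good (Torus.geometry d) ε ∧
          outRep (Torus.geometry d) (m + 1) i (gainConfig (Torus.geometry d) ε Z' i q.1 q.2) ∈ R) ∧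
        (⟪(q.1 : EuclideanSpace ℝ d), q.2 - (Z' i).2⟫_ℝ < 0 →
          lossConfig (Torus.geometry d) ε Z' i q.1 q.2 ∈ hardSphereDomain (Torus.geometry d) (m + 1 + 1) ε →
          outRep (Torus.geometry d) (m + 1) i (lossConfig (Torus.geometry d) ε Z' i q.1 q.2) ∈
            Alexander.good (Torus.geometry d) ε ∧
          outRep (Torus.geometry d) (m + 1) i (lossConfig (Torus.geometry d) ε Z' i q.1 q.2) ∈ R) := by
  classical
  haveI hσf : IsFiniteMeasure (sphereMeasure (E := EuclideanSpace ℝ d)) :=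
    Literature.Analysis.FluidPDE.isFiniteMeasure_sphereMeasure (E := EuclideanSpace ℝ d)
  haveI hσs : SigmaFinite (sphereMeasure (E := EuclideanSpace ℝ d)) := @IsFiniteMeasure.toSigmaFinite _ _ _ hσf
  haveI hXE : SigmaFinite (volume : Measure (UnitAddTorus d × EuclideanSpace ℝ d)) := inferInstance
  haveI hC : SigmaFinite (volume : Measure (Config (m + 1) d (UnitAddTorus d))) := inferInstance
  set G := Torus.geometry d with hG
  -- the null pathological set of the persistent property "good and regular"
  set T : Set (Config (m + 1 + 1) d (UnitAddTorus d)) := hardSphereDomain G (m + 1 + 1) ε ∩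
    ((Alexander.good (N := m + 1 + 1) G ε)ᶜ ∪ Rᶜ) with hT
  have hgood : MeasurableSet (Alexander.good (N := m + 1 + 1) G ε) :=
    (Alexander.regHardSphereFlow (d := d) hε hε' (m + 1 + 1)).measurableSet_good
  have hD : MeasurableSet (hardSphereDomain G (m + 1 + 1) ε) :=
    measurableSet_hardSphereDomain _ Torus.measurable_geometry_sepVec (m + 1 + 1) ε
  have hTm : MeasurableSet T := hD.inter (hgood.compl.union hRm.compl)
  have hT0 : volume T = 0 := by
    have h1 : volume (hardSphereDomain G (m + 1 + 1) ε ∩ (Alexander.good (N := m + 1 + 1) G ε)ᶜ) = 0 := by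
      have h : liouville G (m + 1 + 1) ε (Alexander.good (N := m + 1 + 1) G ε)ᶜ = 0 :=
        Alexander.torusFlow_ae_good_holds (d := d) hε hε' (m + 1 + 1)
      rw [liouville, Measure.restrict_apply hgood.compl] at h
      rwa [inter_comm] at h
    refine measure_mono_null (fun W hW => ?_) (measure_union_null h1 hR0)
    rcases hW.2 with hW2 | hW2
    · exact Or.inl ⟨hW.1, hW2⟩
    · exact Or.inr hW2
  -- the flux engine
  have hE := ae_lossConfig_of_persistent (d := d) hd hε hε' i hTm hT0
    (fun W => W ∈ Alexander.good (N := m + 1 + 1) G ε ∧ W ∈ R) hpers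
  -- the engine set and its measurability
  set M : Set (Config (m + 1) d (UnitAddTorus d) × (sphere (0 : EuclideanSpace ℝ d) 1 × EuclideanSpace ℝ d)) :=
    {x | 0 < ⟪x.2.2 - (x.1 i).2, (x.2.1 : EuclideanSpace ℝ d)⟫_ℝ →
      lossConfig G ε x.1 i x.2.1 x.2.2 ∈ hardSphereDomain G (m + 1 + 1) ε →
      lossConfig G ε x.1 i x.2.1 x.2.2 ∈ Alexander.good (N := m + 1 + 1) G ε ∧
        lossConfig G ε x.1 i x.2.1 x.2.2 ∈ R} with hM
  have hMm : MeasurableSet M := by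
    have hGm := Torus.isMeasurable_geometry (d := d)
    have hω : Measurable fun x : Config (m + 1) d (UnitAddTorus d) × (sphere (0 : EuclideanSpace ℝ d) 1 × EuclideanSpace ℝ d) =>
        (x.2.1 : EuclideanSpace ℝ d) := measurable_subtype_coe.comp measurable_snd.fst
    have hw : Measurable fun x : Config (m + 1) d (UnitAddTorus d) × (sphere (0 : EuclideanSpace ℝ d) 1 × EuclideanSpace ℝ d) =>
        x.2.2 := measurable_snd.snd
    have hflux : Measurable fun x : Config (m + 1) d (UnitAddTorus d) × (sphere (0 : EuclideanSpace ℝ d) 1 × EuclideanSpace ℝ d) =>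
        ⟪x.2.2 - (x.1 i).2, (x.2.1 : EuclideanSpace ℝ d)⟫_ℝ :=
      (hw.sub ((measurable_pi_apply i).comp measurable_fst).snd).inner hω
    have hloss := measurable_lossConfig hGm.measurable_translate ε i measurable_fst hω hw
    exact measurableSet_imp (measurableSet_lt measurable_const hflux)
      (measurableSet_imp (hD.preimage hloss) ((hgood.preimage hloss).inter (hRm.preimage hloss)))
  -- (B1) product form of the engine's statement
  have hB1 : ∀ᵐ Z' : Config (m + 1) d (UnitAddTorus d),
      ∀ᵐ q ∂((sphereMeasure (E := EuclideanSpace ℝ d)).prod (volume : Measure (EuclideanSpace ℝ d))), (Z', q) ∈ M := by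
    filter_upwards [hE] with Z' hZ'
    have hmeas : MeasurableSet {y : EuclideanSpace ℝ d × sphere (0 : EuclideanSpace ℝ d) 1 | (Z', (y.2, y.1)) ∈ M} :=
      hMm.preimage (measurable_const.prodMk (measurable_snd.prodMk measurable_fst))
    have h1 := (Measure.ae_ae_comm (μ := (volume : Measure (EuclideanSpace ℝ d))) (ν := sphereMeasure (E := EuclideanSpace ℝ d))
      (p := fun (w : EuclideanSpace ℝ d) (ν : sphere (0 : EuclideanSpace ℝ d) 1) => (Z', (ν, w)) ∈ M) hmeas).1 hZ'
    have hmeas' : MeasurableSet {q : sphere (0 : EuclideanSpace ℝ d) 1 × EuclideanSpace ℝ d | (Z', q) ∈ M} :=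
      hMm.preimage (measurable_const.prodMk measurable_id)
    exact (Measure.ae_prod_iff_ae_ae (μ := sphereMeasure (E := EuclideanSpace ℝ d)) (ν := (volume : Measure (EuclideanSpace ℝ d)))
      hmeas').2 h1
  -- (B2) the scattered form
  have hprod : ∀ᵐ p ∂((volume : Measure (Config (m + 1) d (UnitAddTorus d))).prod
      ((sphereMeasure (E := EuclideanSpace ℝ d)).prod (volume : Measure (EuclideanSpace ℝ d)))), p ∈ M :=
    (Measure.ae_prod_iff_ae_ae hMm).2 hB1
  have hΞ := measurePreserving_scatterSkew (d := d) i
  have hprod' := hΞ.quasiMeasurePreserving.ae hprod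
  have hB2 := (Measure.ae_prod_iff_ae_ae (hMm.preimage hΞ.measurable)).1 hprod'
  -- combine and rewrite the two clauses
  filter_upwards [hB1, hB2] with Z' h1 h2
  filter_upwards [h1, h2] with q hq1 hq2
  simp only [hM, mem_setOf_eq] at hq1 hq2
  constructor
  · intro hflux hDom
    rw [outRep_gainConfig_torus hε hε']
    rw [gainConfig_mem_hardSphereDomain_iff hε hε'] at hDom
    exact hq1 (by rwa [real_inner_comm] at hflux) hDom
  · intro hflux hDom
    rw [outRep_lossConfig_torus hε hε', gainConfig_eq_lossConfig_scatterParams]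
    refine hq2 ?_ ?_
    · rw [inner_scatterParams, real_inner_comm]
      linarith
    · rw [← gainConfig_eq_lossConfig_scatterParams, gainConfig_mem_hardSphereDomain_iff hε hε']
      exact hDom


/-- **Almost every outgoing adjoined configuration is good and avoids a space-time null set**,
in the form read by the outgoing collision operator: for a `dt ⊗ dZ`-null measurable
`𝒩 ⊆ ℝ × D^{k+1}`, for almost every `k`-configuration `Y` and `σ ⊗ dv`-almost every `(ω, v)`,
in the gain case as in the loss case, the outgoing representative `W` of the adjoined
configuration (when in the domain) is good and `(t₂, Φ_{-s} W) ∉ 𝒩` for almost every `(t₂, s)`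
(`ae_goodClause_of_persistent` with `R` the avoidance set: `ae_avoidsAE`,
`freeFlight_mem_of_not_goodAvoids`). [cite: BodineauGallagherSaintRaymondInvent2016, §3.1 Remark 3.1, p. 9] -/
theorem ae_avoidsClause (hd : 2 ≤ Fintype.card d) {m : ℕ} (i : Fin (m + 1))
    {𝒩 : Set (ℝ × Config (m + 1 + 1) d (UnitAddTorus d))} (h𝒩m : MeasurableSet 𝒩)
    (h𝒩0 : ((volume : Measure ℝ).prod (volume : Measure (Config (m + 1 + 1) d (UnitAddTorus d)))) 𝒩 = 0) :
    ∀ᵐ Z' : Config (m + 1) d (UnitAddTorus d),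
      ∀ᵐ q : sphere (0 : EuclideanSpace ℝ d) 1 × EuclideanSpace ℝ d
          ∂((sphereMeasure (E := EuclideanSpace ℝ d)).prod volume),
        (0 < ⟪(q.1 : EuclideanSpace ℝ d), q.2 - (Z' i).2⟫_ℝ →
          gainConfig (Torus.geometry d) ε Z' i q.1 q.2 ∈ hardSphereDomain (Torus.geometry d) (m + 1 + 1) ε →
          outRep (Torus.geometry d) (m + 1) i (gainConfig (Torus.geometry d) ε Z' i q.1 q.2) ∈
            Alexander.good (Torus.geometry d) ε ∧
          ∀ᵐ p : ℝ × ℝ ∂((volume : Measure ℝ).prod (volume : Measure ℝ)),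
            (p.1, Alexander.regFlow (Torus.geometry d) ε (-p.2)
              (outRep (Torus.geometry d) (m + 1) i (gainConfig (Torus.geometry d) ε Z' i q.1 q.2))) ∉ 𝒩) ∧
        (⟪(q.1 : EuclideanSpace ℝ d), q.2 - (Z' i).2⟫_ℝ < 0 →
          lossConfig (Torus.geometry d) ε Z' i q.1 q.2 ∈ hardSphereDomain (Torus.geometry d) (m + 1 + 1) ε →
          outRep (Torus.geometry d) (m + 1) i (lossConfig (Torus.geometry d) ε Z' i q.1 q.2) ∈
            Alexander.good (Torus.geometry d) ε ∧
          ∀ᵐ p : ℝ × ℝ ∂((volume : Measure ℝ).prod (volume : Measure ℝ)),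
            (p.1, Alexander.regFlow (Torus.geometry d) ε (-p.2)
              (outRep (Torus.geometry d) (m + 1) i (lossConfig (Torus.geometry d) ε Z' i q.1 q.2))) ∉ 𝒩) := by
  have hRm := measurableSet_setOf_avoids hε' (k := m + 1 + 1) h𝒩m
  have hR0 : volume {W : Config (m + 1 + 1) d (UnitAddTorus d) |
      ∀ᵐ p : ℝ × ℝ ∂((volume : Measure ℝ).prod (volume : Measure ℝ)),
        (p.1, Alexander.regFlow (Torus.geometry d) ε (-p.2) W) ∉ 𝒩}ᶜ = 0 := by
    have := ae_avoidsAE hε hε' h𝒩m h𝒩0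
    rw [ae_iff] at this
    simpa only [compl_setOf] using this
  exact ae_goodClause_of_persistent hε hε' hd i hRm hR0
    (fun W₀ τ hτ0 _ hwin hnot => freeFlight_mem_of_not_goodAvoids hε hε' hτ0 hwin hnot)

end Avoid

/-! ## §2. The Duhamel integrands agree off a space-time null set -/

section Integrand

variable {ε : ℝ} (hε : 0 < ε) (hε' : ε < 2⁻¹) (M₀ : ℕ)

/-- **The outgoing collision operator only reads its argument through the two clauses**: if for
every label and `σ ⊗ dv`-a.e. `(ω, v)` two functions agree at the outgoing representative of the
gain configuration when `⟪ω, v - v_i⟫ > 0` and of the loss configuration when `⟪ω, v - v_i⟫ < 0`,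
their images under `C^{out}_{k,k+1}` agree at `Y`. [folklore] -/
theorem outBbgkyOp_congr_of_ae_clause {m : ℕ} {g₁ g₂ : Config (m + 1 + 1) d (UnitAddTorus d) → ℝ}
    {Y : Config (m + 1) d (UnitAddTorus d)}
    (h : ∀ i : Fin (m + 1), ∀ᵐ q : sphere (0 : EuclideanSpace ℝ d) 1 × EuclideanSpace ℝ d
        ∂((sphereMeasure (E := EuclideanSpace ℝ d)).prod volume),
      (0 < ⟪(q.1 : EuclideanSpace ℝ d), q.2 - (Y i).2⟫_ℝ →
        g₁ (outRep (Torus.geometry d) (m + 1) i (gainConfig (Torus.geometry d) ε Y i q.1 q.2)) =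
          g₂ (outRep (Torus.geometry d) (m + 1) i (gainConfig (Torus.geometry d) ε Y i q.1 q.2))) ∧
      (⟪(q.1 : EuclideanSpace ℝ d), q.2 - (Y i).2⟫_ℝ < 0 →
        g₁ (outRep (Torus.geometry d) (m + 1) i (lossConfig (Torus.geometry d) ε Y i q.1 q.2)) =
          g₂ (outRep (Torus.geometry d) (m + 1) i (lossConfig (Torus.geometry d) ε Y i q.1 q.2)))) :
    outBbgkyOp (Torus.geometry d) ε M₀ (m + 1) g₁ Y = outBbgkyOp (Torus.geometry d) ε M₀ (m + 1) g₂ Y := by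
  haveI hσf : IsFiniteMeasure (sphereMeasure (E := EuclideanSpace ℝ d)) :=
    Literature.Analysis.FluidPDE.isFiniteMeasure_sphereMeasure (E := EuclideanSpace ℝ d)
  haveI hσs : SigmaFinite (sphereMeasure (E := EuclideanSpace ℝ d)) := @IsFiniteMeasure.toSigmaFinite _ _ _ hσf
  unfold outBbgkyOp bbgkyCollisionOp
  refine Finset.sum_congr rfl fun i _ => ?_
  congr 1
  unfold hsCollisionTerm
  refine integral_congr_ae ?_
  filter_upwards [Measure.ae_ae_of_ae_prod (h i)] with ω hω
  refine integral_congr_ae ?_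
  filter_upwards [hω] with v hv
  simp only [Function.comp_apply]
  rcases lt_trichotomy ⟪(ω : EuclideanSpace ℝ d), v - (Y i).2⟫_ℝ 0 with hlt | heq | hgt
  · rw [max_eq_right hlt.le, (hv.2 hlt)]
    simp
  · rw [heq, neg_zero, max_self]
    simp
  · rw [max_eq_right (by linarith : -⟪(ω : EuclideanSpace ℝ d), v - (Y i).2⟫_ℝ ≤ 0), hv.1 hgt]
    simp

include hε hε'

/-- **The pipeline from the avoidance clause to the a.e. agreement of the collision integrands.**
Let `u₁, u₂ : ℝ × D^{k+1} → ℝ` be jointly measurable reads vanishing off the domain, and `𝒩` a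
`dt ⊗ dZ`-null measurable set such that every good `W` avoiding `𝒩` (a.e. in `(t₂, s)`) has
`u₁(t, W) = u₂(t, W)` for almost every `t`. Then for `dt ⊗ dY`-almost every `(t, Y)`,
`C^{out}_{k,k+1}(u₁(t, ·))(Y) = C^{out}_{k,k+1}(u₂(t, ·))(Y)` (`ae_avoidsClause`, Fubini,
`outBbgkyOp_congr_of_ae_clause`). [folklore] -/
theorem ae_prod_outBbgkyOp_eq (hd : 2 ≤ Fintype.card d) {m : ℕ}
    {u₁ u₂ : ℝ × Config (m + 1 + 1) d (UnitAddTorus d) → ℝ} (hu₁ : Measurable u₁) (hu₂ : Measurable u₂)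
    (hs₁ : ∀ (t : ℝ) (W : Config (m + 1 + 1) d (UnitAddTorus d)),
      W ∉ hardSphereDomain (Torus.geometry d) (m + 1 + 1) ε → u₁ (t, W) = 0)
    (hs₂ : ∀ (t : ℝ) (W : Config (m + 1 + 1) d (UnitAddTorus d)),
      W ∉ hardSphereDomain (Torus.geometry d) (m + 1 + 1) ε → u₂ (t, W) = 0)
    {𝒩 : Set (ℝ × Config (m + 1 + 1) d (UnitAddTorus d))} (h𝒩m : MeasurableSet 𝒩)
    (h𝒩0 : ((volume : Measure ℝ).prod (volume : Measure (Config (m + 1 + 1) d (UnitAddTorus d)))) 𝒩 = 0)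
    (havoid : ∀ W : Config (m + 1 + 1) d (UnitAddTorus d), W ∈ Alexander.good (N := m + 1 + 1) (Torus.geometry d) ε →
      (∀ᵐ p : ℝ × ℝ ∂((volume : Measure ℝ).prod (volume : Measure ℝ)),
        (p.1, Alexander.regFlow (Torus.geometry d) ε (-p.2) W) ∉ 𝒩) →
      ∀ᵐ t : ℝ, u₁ (t, W) = u₂ (t, W)) :
    ∀ᵐ x : ℝ × Config (m + 1) d (UnitAddTorus d) ∂((volume : Measure ℝ).prod volume),
      outBbgkyOp (Torus.geometry d) ε M₀ (m + 1) (fun W => u₁ (x.1, W)) x.2 =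
        outBbgkyOp (Torus.geometry d) ε M₀ (m + 1) (fun W => u₂ (x.1, W)) x.2 := by
  classical
  haveI hσf : IsFiniteMeasure (sphereMeasure (E := EuclideanSpace ℝ d)) :=
    Literature.Analysis.FluidPDE.isFiniteMeasure_sphereMeasure (E := EuclideanSpace ℝ d)
  haveI hσs : SigmaFinite (sphereMeasure (E := EuclideanSpace ℝ d)) := @IsFiniteMeasure.toSigmaFinite _ _ _ hσf
  haveI hXE : SigmaFinite (volume : Measure (UnitAddTorus d × EuclideanSpace ℝ d)) := inferInstance
  haveI hC : SigmaFinite (volume : Measure (Config (m + 1) d (UnitAddTorus d))) := inferInstance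
  set G := Torus.geometry d with hG
  set κ : Measure (sphere (0 : EuclideanSpace ℝ d) 1 × EuclideanSpace ℝ d) :=
    (sphereMeasure (E := EuclideanSpace ℝ d)).prod volume with hκ
  haveI hκs : SigmaFinite κ := by rw [hκ]; infer_instance
  -- the agreement predicate
  set Agree : ℝ → Config (m + 1) d (UnitAddTorus d) → Fin (m + 1) → sphere (0 : EuclideanSpace ℝ d) 1 × EuclideanSpace ℝ d → Prop :=
    fun t Y i q =>
      (0 < ⟪(q.1 : EuclideanSpace ℝ d), q.2 - (Y i).2⟫_ℝ →
        u₁ (t, outRep G (m + 1) i (gainConfig G ε Y i q.1 q.2)) = u₂ (t, outRep G (m + 1) i (gainConfig G ε Y i q.1 q.2))) ∧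
      (⟪(q.1 : EuclideanSpace ℝ d), q.2 - (Y i).2⟫_ℝ < 0 →
        u₁ (t, outRep G (m + 1) i (lossConfig G ε Y i q.1 q.2)) = u₂ (t, outRep G (m + 1) i (lossConfig G ε Y i q.1 q.2)))
    with hAgree
  -- measurability of the agreement set in all variables `((Y, q), t)`
  have hGm := Torus.isMeasurable_geometry (d := d)
  have hmeasA : ∀ i : Fin (m + 1), MeasurableSet {x : (Config (m + 1) d (UnitAddTorus d) ×
      (sphere (0 : EuclideanSpace ℝ d) 1 × EuclideanSpace ℝ d)) × ℝ | Agree x.2 x.1.1 i x.1.2} := by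
    intro i
    have hY : Measurable fun x : (Config (m + 1) d (UnitAddTorus d) × (sphere (0 : EuclideanSpace ℝ d) 1 × EuclideanSpace ℝ d)) × ℝ =>
        x.1.1 := measurable_fst.fst
    have hω : Measurable fun x : (Config (m + 1) d (UnitAddTorus d) × (sphere (0 : EuclideanSpace ℝ d) 1 × EuclideanSpace ℝ d)) × ℝ =>
        (x.1.2.1 : EuclideanSpace ℝ d) := measurable_subtype_coe.comp measurable_fst.snd.fst
    have hv : Measurable fun x : (Config (m + 1) d (UnitAddTorus d) × (sphere (0 : EuclideanSpace ℝ d) 1 × EuclideanSpace ℝ d)) × ℝ =>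
        x.1.2.2 := measurable_fst.snd.snd
    have ht : Measurable fun x : (Config (m + 1) d (UnitAddTorus d) × (sphere (0 : EuclideanSpace ℝ d) 1 × EuclideanSpace ℝ d)) × ℝ =>
        x.2 := measurable_snd
    have hflux : Measurable fun x : (Config (m + 1) d (UnitAddTorus d) × (sphere (0 : EuclideanSpace ℝ d) 1 × EuclideanSpace ℝ d)) × ℝ =>
        ⟪(x.1.2.1 : EuclideanSpace ℝ d), x.1.2.2 - (x.1.1 i).2⟫_ℝ := hω.inner (hv.sub ((measurable_pi_apply i).comp hY).snd)
    have hgain := (measurable_outRep hGm (m + 1) i).comp (measurable_gainConfig hGm.measurable_translate ε i hY hω hv)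
    have hloss := (measurable_outRep hGm (m + 1) i).comp (measurable_lossConfig hGm.measurable_translate ε i hY hω hv)
    have hg₁ := hu₁.comp (ht.prodMk hgain)
    have hg₂ := hu₂.comp (ht.prodMk hgain)
    have hl₁ := hu₁.comp (ht.prodMk hloss)
    have hl₂ := hu₂.comp (ht.prodMk hloss)
    exact (measurableSet_imp (measurableSet_lt measurable_const hflux) (measurableSet_eq_fun hg₁ hg₂)).inter
      (measurableSet_imp (measurableSet_lt hflux measurable_const) (measurableSet_eq_fun hl₁ hl₂))
  -- Step 1: a.e. `Y`, for every label, a.e. `q`, a.e. `t`: agreement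
  have hstep1 : ∀ i : Fin (m + 1), ∀ᵐ Y : Config (m + 1) d (UnitAddTorus d), ∀ᵐ q ∂κ, ∀ᵐ t : ℝ, Agree t Y i q := by
    intro i
    filter_upwards [ae_avoidsClause hε hε' hd i h𝒩m h𝒩0] with Y hY
    filter_upwards [hY] with q hq
    obtain ⟨hqg, hql⟩ := hq
    -- gain clause, a.e. in `t`
    have h1 : ∀ᵐ t : ℝ, 0 < ⟪(q.1 : EuclideanSpace ℝ d), q.2 - (Y i).2⟫_ℝ →
        u₁ (t, outRep G (m + 1) i (gainConfig G ε Y i q.1 q.2)) = u₂ (t, outRep G (m + 1) i (gainConfig G ε Y i q.1 q.2)) := by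
      by_cases hflux : 0 < ⟪(q.1 : EuclideanSpace ℝ d), q.2 - (Y i).2⟫_ℝ
      · by_cases hD : gainConfig G ε Y i q.1 q.2 ∈ hardSphereDomain G (m + 1 + 1) ε
        · obtain ⟨hgood, hav⟩ := hqg hflux hD
          filter_upwards [havoid _ hgood hav] with t ht
          exact fun _ => ht
        · have hW : outRep G (m + 1) i (gainConfig G ε Y i q.1 q.2) ∉ hardSphereDomain G (m + 1 + 1) ε := by
            rwa [outRep_mem_hardSphereDomain_iff]
          exact ae_of_all _ fun t _ => by rw [hs₁ t _ hW, hs₂ t _ hW]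
      · exact ae_of_all _ fun t h => absurd h hflux
    have h2 : ∀ᵐ t : ℝ, ⟪(q.1 : EuclideanSpace ℝ d), q.2 - (Y i).2⟫_ℝ < 0 →
        u₁ (t, outRep G (m + 1) i (lossConfig G ε Y i q.1 q.2)) = u₂ (t, outRep G (m + 1) i (lossConfig G ε Y i q.1 q.2)) := by
      by_cases hflux : ⟪(q.1 : EuclideanSpace ℝ d), q.2 - (Y i).2⟫_ℝ < 0
      · by_cases hD : lossConfig G ε Y i q.1 q.2 ∈ hardSphereDomain G (m + 1 + 1) ε
        · obtain ⟨hgood, hav⟩ := hql hflux hD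
          filter_upwards [havoid _ hgood hav] with t ht
          exact fun _ => ht
        · have hW : outRep G (m + 1) i (lossConfig G ε Y i q.1 q.2) ∉ hardSphereDomain G (m + 1 + 1) ε := by
            rwa [outRep_mem_hardSphereDomain_iff]
          exact ae_of_all _ fun t _ => by rw [hs₁ t _ hW, hs₂ t _ hW]
      · exact ae_of_all _ fun t h => absurd h hflux
    filter_upwards [h1, h2] with t ht1 ht2
    exact ⟨ht1, ht2⟩
  -- Step 2: move `t` outermost
  have hstep2 : ∀ i : Fin (m + 1), ∀ᵐ t : ℝ, ∀ᵐ Y : Config (m + 1) d (UnitAddTorus d), ∀ᵐ q ∂κ, Agree t Y i q := by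
    intro i
    -- to the product `(Y, q)`
    have hmeasYq : MeasurableSet {y : Config (m + 1) d (UnitAddTorus d) × (sphere (0 : EuclideanSpace ℝ d) 1 × EuclideanSpace ℝ d) |
        ∀ᵐ t : ℝ, Agree t y.1 i y.2} :=
      measurableSet_setOf_ae_mem (volume : Measure ℝ) (hmeasA i)
    have h1 : ∀ᵐ y ∂((volume : Measure (Config (m + 1) d (UnitAddTorus d))).prod κ), ∀ᵐ t : ℝ, Agree t y.1 i y.2 :=
      (Measure.ae_prod_iff_ae_ae hmeasYq).2 (hstep1 i)
    -- to the product `((Y, q), t)`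
    have h2 : ∀ᵐ x ∂(((volume : Measure (Config (m + 1) d (UnitAddTorus d))).prod κ).prod (volume : Measure ℝ)),
        Agree x.2 x.1.1 i x.1.2 :=
      (Measure.ae_prod_iff_ae_ae (hmeasA i)).2 h1
    -- swap to `(t, (Y, q))`
    have h3 : ∀ᵐ x ∂((volume : Measure ℝ).prod (((volume : Measure (Config (m + 1) d (UnitAddTorus d))).prod κ))),
        Agree x.1 x.2.1 i x.2.2 :=
      (Measure.measurePreserving_swap (μ := (volume : Measure ℝ))
        (ν := ((volume : Measure (Config (m + 1) d (UnitAddTorus d))).prod κ))).quasiMeasurePreserving.ae h2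
    have h4 := Measure.ae_ae_of_ae_prod h3
    filter_upwards [h4] with t ht
    exact Measure.ae_ae_of_ae_prod ht
  -- Step 3: all labels, and the product `(t, Y)`
  have hstep3 : ∀ᵐ t : ℝ, ∀ᵐ Y : Config (m + 1) d (UnitAddTorus d), ∀ i, ∀ᵐ q ∂κ, Agree t Y i q := by
    have := ae_all_iff.2 hstep2
    filter_upwards [this] with t ht
    exact ae_all_iff.2 fun i => by
      filter_upwards [ht i] with Y hY using hY
  have hmeasTY : MeasurableSet {x : ℝ × Config (m + 1) d (UnitAddTorus d) | ∀ i, ∀ᵐ q ∂κ, Agree x.1 x.2 i q} := by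
    rw [Set.setOf_forall]
    refine MeasurableSet.iInter fun i => ?_
    have hre : Measurable fun z : (ℝ × Config (m + 1) d (UnitAddTorus d)) × (sphere (0 : EuclideanSpace ℝ d) 1 × EuclideanSpace ℝ d) =>
        (((z.1.2, z.2), z.1.1) : (Config (m + 1) d (UnitAddTorus d) × (sphere (0 : EuclideanSpace ℝ d) 1 × EuclideanSpace ℝ d)) × ℝ) :=
      (measurable_fst.snd.prodMk measurable_snd).prodMk measurable_fst.fst
    exact measurableSet_setOf_ae_mem κ ((hmeasA i).preimage hre)
  have hprod : ∀ᵐ x : ℝ × Config (m + 1) d (UnitAddTorus d) ∂((volume : Measure ℝ).prod volume),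
      ∀ i, ∀ᵐ q ∂κ, Agree x.1 x.2 i q :=
    (Measure.ae_prod_iff_ae_ae (μ := (volume : Measure ℝ)) (ν := (volume : Measure (Config (m + 1) d (UnitAddTorus d))))
      (p := fun x : ℝ × Config (m + 1) d (UnitAddTorus d) => ∀ i, ∀ᵐ q ∂κ, Agree x.1 x.2 i q) hmeasTY).2 hstep3
  filter_upwards [hprod] with x hx
  exact outBbgkyOp_congr_of_ae_clause M₀ hx

omit hε hε' in
/-- **The reads of order `0` agree for almost every time** at a good configuration avoiding
`ℝ × {G₁^{(k)} ≠ G₂^{(k)}}`: `G₁^{(k)}(Φ_{-t} W) = G₂^{(k)}(Φ_{-t} W)` for a.e. `t`. [folklore] -/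
theorem ae_read_zero_eq {k : ℕ} {g₁ g₂ : Config k d (UnitAddTorus d) → ℝ} (W : Config k d (UnitAddTorus d))
    (hav : ∀ᵐ p : ℝ × ℝ ∂((volume : Measure ℝ).prod (volume : Measure ℝ)),
      (p.1, Alexander.regFlow (Torus.geometry d) ε (-p.2) W) ∉ (univ : Set ℝ) ×ˢ {V | g₁ V ≠ g₂ V}) :
    ∀ᵐ t : ℝ, g₁ (Alexander.regFlow (Torus.geometry d) ε (-t) W) = g₂ (Alexander.regFlow (Torus.geometry d) ε (-t) W) := by
  have h := Measure.ae_ae_of_ae_prod hav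
  obtain ⟨t₂, ht₂⟩ := h.exists
  filter_upwards [ht₂] with s hs
  simpa [mem_prod] using hs

omit hε hε' in
/-- **The reads of positive order agree for almost every time** at a good configuration
avoiding `{E₁ ≠ E₂}`: the shear `(t, t₂) ↦ (t₂, t - t₂)` preserves `dt ⊗ dt₂`
(`measurePreserving_prod_sub_swap`), so `E₁(t₂, Φ_{-(t-t₂)} W) = E₂(t₂, Φ_{-(t-t₂)} W)` for a.e.
`(t, t₂)`, and the interval integrals over `t₂ ∈ (0, t)` agree for a.e. `t`. [folklore] -/
theorem ae_read_succ_eq {k : ℕ} {E₁ E₂ : ℝ × Config k d (UnitAddTorus d) → ℝ} (W : Config k d (UnitAddTorus d))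
    (hav : ∀ᵐ p : ℝ × ℝ ∂((volume : Measure ℝ).prod (volume : Measure ℝ)),
      (p.1, Alexander.regFlow (Torus.geometry d) ε (-p.2) W) ∉ {x | E₁ x ≠ E₂ x}) :
    ∀ᵐ t : ℝ, ∫ t₂ in (0 : ℝ)..t, E₁ (t₂, Alexander.regFlow (Torus.geometry d) ε (-(t - t₂)) W) =
      ∫ t₂ in (0 : ℝ)..t, E₂ (t₂, Alexander.regFlow (Torus.geometry d) ε (-(t - t₂)) W) := by
  have hsh := (measurePreserving_prod_sub_swap (volume : Measure ℝ) (volume : Measure ℝ)).quasiMeasurePreserving.ae hav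
  have h := Measure.ae_ae_of_ae_prod hsh
  filter_upwards [h] with t ht
  refine intervalIntegral.integral_congr_ae ?_
  filter_upwards [ht] with t₂ ht₂ _
  simpa using ht₂

/-- Unfolding of the Duhamel terms of positive order of the hard-sphere model. [folklore] -/
theorem duhamelTerm_succ_hsHierarchyModel (n k : ℕ) (t : ℝ) (F : GCState d (UnitAddTorus d)) (Z : Config k d (UnitAddTorus d)) :
    duhamelTerm (hsHierarchyModel (d := d) hε hε' M₀).transport (hsHierarchyModel hε hε' M₀).op (n + 1) k t F Z =
      ∫ t₂ in (0 : ℝ)..t, outBbgkyOp (Torus.geometry d) ε M₀ k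
        (duhamelTerm (hsHierarchyModel (d := d) hε hε' M₀).transport (hsHierarchyModel hε hε' M₀).op n (k + 1) t₂ F)
        (Alexander.regFlow (Torus.geometry d) ε (-(t - t₂)) Z) := by
  rw [duhamelTerm_succ]
  rfl

/-- The Duhamel integrand `E_n(G)(k, t, Y) = C^{out}_{k,k+1}(Q_{k+1,k+1+n}(t) G)(Y)` is jointly
measurable in `(t, Y)` for a nice family. [folklore] -/
theorem measurable_hsDuhamelIntegrand {F : GCState d (UnitAddTorus d)} (hF : ∀ k, IsNice (F k)) (n k : ℕ) :
    Measurable fun x : ℝ × Config k d (UnitAddTorus d) =>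
      outBbgkyOp (Torus.geometry d) ε M₀ k
        (duhamelTerm (hsHierarchyModel (d := d) hε hε' M₀).transport (hsHierarchyModel hε hε' M₀).op n (k + 1) x.1 F) x.2 :=
  (hsHierarchyModel (d := d) hε hε' M₀).measurable_op k
    (isNiceT_duhamelTerm (T := 0) (hsHierarchyModel (d := d) hε hε' M₀) hF n (k + 1)).measurable

/-- **The induction**: for nice families `G₁ = G₂` a.e. vanishing off the hard-sphere domains,
at every order `n` and level `k`, (A) the Duhamel terms `Q_{k,k+n}(h) G₁ = Q_{k,k+n}(h) G₂`
Lebesgue-a.e. for every `h`, and (B) the Duhamel integrands `E_n(G₁)(k, ·, ·) = E_n(G₂)(k, ·, ·)`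
`dt ⊗ dY`-a.e. [cite: BodineauGallagherSaintRaymondInvent2016, §3.1 Remark 3.1, p. 9] -/
theorem ae_duhamelTerm_eq_and (hd : 2 ≤ Fintype.card d) {G₁ G₂ : GCState d (UnitAddTorus d)}
    (h₁ : ∀ k, IsNice (G₁ k)) (h₂ : ∀ k, IsNice (G₂ k))
    (s₁ : ∀ (k : ℕ) (Z : Config k d (UnitAddTorus d)), Z ∉ hardSphereDomain (Torus.geometry d) k ε → G₁ k Z = 0)
    (s₂ : ∀ (k : ℕ) (Z : Config k d (UnitAddTorus d)), Z ∉ hardSphereDomain (Torus.geometry d) k ε → G₂ k Z = 0)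
    (hae : ∀ k, G₁ k =ᵐ[volume] G₂ k) :
    ∀ n k : ℕ,
      (∀ h : ℝ, duhamelTerm (hsHierarchyModel (d := d) hε hε' M₀).transport (hsHierarchyModel hε hε' M₀).op n k h G₁ =ᵐ[volume]
        duhamelTerm (hsHierarchyModel (d := d) hε hε' M₀).transport (hsHierarchyModel hε hε' M₀).op n k h G₂) ∧
      (∀ᵐ x : ℝ × Config k d (UnitAddTorus d) ∂((volume : Measure ℝ).prod volume),
        outBbgkyOp (Torus.geometry d) ε M₀ k
            (duhamelTerm (hsHierarchyModel (d := d) hε hε' M₀).transport (hsHierarchyModel hε hε' M₀).op n (k + 1) x.1 G₁) x.2 =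
          outBbgkyOp (Torus.geometry d) ε M₀ k
            (duhamelTerm (hsHierarchyModel (d := d) hε hε' M₀).transport (hsHierarchyModel hε hε' M₀).op n (k + 1) x.1 G₂) x.2) := by
  haveI hXE : SigmaFinite (volume : Measure (UnitAddTorus d × EuclideanSpace ℝ d)) := inferInstance
  set M := hsHierarchyModel (d := d) hε hε' M₀ with hM
  -- (B) at level `k` from the data of the reads at level `k + 1`
  have partB : ∀ (n k : ℕ),
      (∀ m : ℕ, k = m + 1 →
        ∃ 𝒩 : Set (ℝ × Config (m + 1 + 1) d (UnitAddTorus d)), MeasurableSet 𝒩 ∧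
          ((volume : Measure ℝ).prod (volume : Measure (Config (m + 1 + 1) d (UnitAddTorus d)))) 𝒩 = 0 ∧
          ∀ W : Config (m + 1 + 1) d (UnitAddTorus d), W ∈ Alexander.good (N := m + 1 + 1) (Torus.geometry d) ε →
            (∀ᵐ p : ℝ × ℝ ∂((volume : Measure ℝ).prod (volume : Measure ℝ)),
              (p.1, Alexander.regFlow (Torus.geometry d) ε (-p.2) W) ∉ 𝒩) →
            ∀ᵐ t : ℝ, duhamelTerm M.transport M.op n (m + 1 + 1) t G₁ W = duhamelTerm M.transport M.op n (m + 1 + 1) t G₂ W) →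
      ∀ᵐ x : ℝ × Config k d (UnitAddTorus d) ∂((volume : Measure ℝ).prod volume),
        outBbgkyOp (Torus.geometry d) ε M₀ k (duhamelTerm M.transport M.op n (k + 1) x.1 G₁) x.2 =
          outBbgkyOp (Torus.geometry d) ε M₀ k (duhamelTerm M.transport M.op n (k + 1) x.1 G₂) x.2 := by
    intro n k hdata
    cases k with
    | zero =>
      exact ae_of_all _ fun x => by simp [outBbgkyOp]
    | succ m =>
      obtain ⟨𝒩, h𝒩m, h𝒩0, hav⟩ := hdata m rfl
      have hm₁ := (isNiceT_duhamelTerm (T := 0) M h₁ n (m + 1 + 1)).measurable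
      have hm₂ := (isNiceT_duhamelTerm (T := 0) M h₂ n (m + 1 + 1)).measurable
      exact ae_prod_outBbgkyOp_eq hε hε' M₀ hd (u₁ := fun p => duhamelTerm M.transport M.op n (m + 1 + 1) p.1 G₁ p.2)
        (u₂ := fun p => duhamelTerm M.transport M.op n (m + 1 + 1) p.1 G₂ p.2) hm₁ hm₂
        (fun t W hW => duhamelTerm_hsHierarchyModel_eq_zero_of_not_mem hε hε' M₀ (fun k Z hZ => s₁ k Z hZ) n _ t W hW)
        (fun t W hW => duhamelTerm_hsHierarchyModel_eq_zero_of_not_mem hε hε' M₀ (fun k Z hZ => s₂ k Z hZ) n _ t W hW)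
        h𝒩m h𝒩0 hav
  intro n
  induction n with
  | zero =>
    intro k
    refine ⟨fun h => ?_, partB 0 k fun m _ => ?_⟩
    · -- (A) at order 0: transport of a.e.-equal data
      have := ae_comp_regFlow (d := d) hε hε' (Q := fun Z => G₁ k Z = G₂ k Z) (hae k) (-h)
      filter_upwards [this] with Z hZ
      simpa [duhamelTerm_zero, HierarchyModel.transport_apply, hM] using hZ
    · -- the reads of order 0
      refine ⟨(univ : Set ℝ) ×ˢ {V | G₁ (m + 1 + 1) V ≠ G₂ (m + 1 + 1) V}, ?_, ?_, ?_⟩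
      · exact MeasurableSet.univ.prod (measurableSet_eq_fun (h₁ _).1 (h₂ _).1).compl
      · rw [Measure.prod_prod]
        have : volume {V : Config (m + 1 + 1) d (UnitAddTorus d) | G₁ (m + 1 + 1) V ≠ G₂ (m + 1 + 1) V} = 0 := by
          have := hae (m + 1 + 1)
          rw [EventuallyEq, ae_iff] at this
          exact this
        rw [this, mul_zero]
      · intro W _ hav
        have := ae_read_zero_eq W hav
        filter_upwards [this] with t ht
        simpa [duhamelTerm_zero, HierarchyModel.transport_apply, hM] using ht
  | succ n ih =>
    intro k
    refine ⟨fun h => ?_, partB (n + 1) k fun m _ => ?_⟩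
    · -- (A) at order n+1 from (B) at order n, level k
      obtain ⟨_, hB⟩ := ih k
      set 𝒩 : Set (ℝ × Config k d (UnitAddTorus d)) := {x |
        outBbgkyOp (Torus.geometry d) ε M₀ k (duhamelTerm M.transport M.op n (k + 1) x.1 G₁) x.2 ≠
          outBbgkyOp (Torus.geometry d) ε M₀ k (duhamelTerm M.transport M.op n (k + 1) x.1 G₂) x.2} with h𝒩
      have h𝒩m : MeasurableSet 𝒩 :=
        (measurableSet_eq_fun (measurable_hsDuhamelIntegrand hε hε' M₀ h₁ n k) (measurable_hsDuhamelIntegrand hε hε' M₀ h₂ n k)).compl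
      have h𝒩0 : ((volume : Measure ℝ).prod (volume : Measure (Config k d (UnitAddTorus d)))) 𝒩 = 0 := by
        rw [ae_iff] at hB
        exact hB
      -- a.e. `t₁`: the section is null; transport it along `Φ_{-(h - t₁)}`
      have hsec : ∀ᵐ t₁ : ℝ, ∀ᵐ V : Config k d (UnitAddTorus d), (t₁, V) ∉ 𝒩 :=
        Measure.ae_ae_of_ae_prod (measure_eq_zero_iff_ae_notMem.1 h𝒩0)
      have hall : ∀ᵐ t₁ : ℝ, ∀ᵐ Z : Config k d (UnitAddTorus d),
          (t₁, Alexander.regFlow (Torus.geometry d) ε (-(h - t₁)) Z) ∉ 𝒩 := by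
        filter_upwards [hsec] with t₁ ht₁
        exact ae_comp_regFlow (d := d) hε hε' (Q := fun V => (t₁, V) ∉ 𝒩) ht₁ (-(h - t₁))
      have hmeas : MeasurableSet {x : ℝ × Config k d (UnitAddTorus d) |
          ((x.1, Alexander.regFlow (Torus.geometry d) ε (-(h - x.1)) x.2) : ℝ × Config k d (UnitAddTorus d)) ∉ 𝒩} := by
        refine (h𝒩m.preimage ?_).compl
        have h2 : Measurable fun x : ℝ × Config k d (UnitAddTorus d) => ((-(h - x.1), x.2) : ℝ × Config k d (UnitAddTorus d)) :=
          (measurable_const.sub measurable_fst).neg.prodMk measurable_snd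
        exact measurable_fst.prodMk ((Alexander.measurable_regFlow_uncurry (N := k) (d := d) hε').comp h2)
      have hcomm := (Measure.ae_ae_comm (μ := (volume : Measure ℝ)) (ν := (volume : Measure (Config k d (UnitAddTorus d))))
        (p := fun t₁ Z => ((t₁, Alexander.regFlow (Torus.geometry d) ε (-(h - t₁)) Z) : ℝ × Config k d (UnitAddTorus d)) ∉ 𝒩)
        hmeas).1 hall
      filter_upwards [hcomm] with Z hZ
      rw [duhamelTerm_succ_hsHierarchyModel, duhamelTerm_succ_hsHierarchyModel]
      refine intervalIntegral.integral_congr_ae ?_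
      filter_upwards [hZ] with t₁ ht₁ _
      simpa [h𝒩] using ht₁
    · -- the reads of order n+1, from (B) at order n, level m+2
      obtain ⟨_, hB⟩ := ih (m + 1 + 1)
      refine ⟨{x | outBbgkyOp (Torus.geometry d) ε M₀ (m + 1 + 1) (duhamelTerm M.transport M.op n (m + 1 + 1 + 1) x.1 G₁) x.2 ≠
          outBbgkyOp (Torus.geometry d) ε M₀ (m + 1 + 1) (duhamelTerm M.transport M.op n (m + 1 + 1 + 1) x.1 G₂) x.2}, ?_, ?_, ?_⟩
      · exact (measurableSet_eq_fun (measurable_hsDuhamelIntegrand hε hε' M₀ h₁ n (m + 1 + 1))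
          (measurable_hsDuhamelIntegrand hε hε' M₀ h₂ n (m + 1 + 1))).compl
      · rw [ae_iff] at hB
        exact hB
      · intro W _ hav
        have := ae_read_succ_eq W hav
        filter_upwards [this] with t ht
        rw [duhamelTerm_succ_hsHierarchyModel, duhamelTerm_succ_hsHierarchyModel]
        exact ht

/-- **(R'): the Duhamel terms of the hard-sphere hierarchy respect Lebesgue-null sets on nice
families supported in the hard-sphere domains** (`HierarchyModel.RespectsAEOn`), for `d ≥ 2`
and `0 < ε < 1/2` — BGSR's Remark 3.1 ("this does not really make sense since the
transformation is singular … a standard argument", the non-singularity of the pseudo-trajectories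
of Simonella 2014) in the form consumed by the pruning argument
(`bgsrMarginal_ae_abs_sub_truncSepMain_le_on`, `bodineau_gallagher_saintRaymond_linear_of_inputs`).
[cite: BodineauGallagherSaintRaymondInvent2016, §3.1 Remark 3.1, p. 9] -/
theorem respectsAEOn_hsHierarchyModel (hd : 2 ≤ Fintype.card d) :
    (hsHierarchyModel (d := d) hε hε' M₀).RespectsAEOn (fun _ => volume)
      (fun k => hardSphereDomain (Torus.geometry d) k ε) :=
  fun n s h _ _ _ h₁ h₂ s₁ s₂ hae => (ae_duhamelTerm_eq_and hε hε' M₀ hd h₁ h₂ s₁ s₂ hae n s).1 h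

end Integrand


end Kinetic

end

end Literature.MathematicalPhysics.KineticTheory
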